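import Summits.AtomisticToContinuum.Crystallization.Theorems.FrustratedLawDichotomyStrainedPatchHomEntryLeafHTA2QCellBXA1

/-!
# K1-v2 IN THE KERNEL at the six-coarse mixed cell `cB065 × wBXA`, part 2: ★★★ the certificate side `htCertSideA2Q pBXA2 QBX GnBX JB065 cB065 wBXA = true`
# (27623 `(H) HomFloor (1/625)`, hcp half; hand-1 g35 FINDING §3e)

decomp-a2c hand-1 g35.  KERNEL (seat probe X6_C): `restBXA2`, `linBXA2`, `farBXA2`; with `…CellBXA1.qBX_0/1/2`: ★★★ `htCertSideA2Q_BXA2`.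
Kernel facts + assembly; 0 sorry; standard axioms; no definitions.  `--supports stmt-AtomisticToContinuum-27623`.
-/

namespace Summit.AtomisticToContinuum.Crystallization.Theorems.FrustratedLawDichotomyStrainedPatchHomEntryLeafHT

open Literature.Analysis.ValidatedNumerics.Numerics
open Summit.AtomisticToContinuum.Crystallization.Theorems.FrustratedLawDichotomyStrainedPatchHomCertTree (CertTree treeOK)
open Summit.AtomisticToContinuum.Crystallization.Theorems.FrustratedLawDichotomyStrainedPatchHomEntryTable (muRec)
open Summit.AtomisticToContinuum.Crystallization.Theorems.FrustratedLawDichotomyStrainedPatchHomEntryFitHcpCentred (entryLeafOKHQDCR)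
open Summit.AtomisticToContinuum.Crystallization.Theorems.FrustratedLawDichotomyStrainedPatchHomSlopeLJ
open Summit.AtomisticToContinuum.Crystallization.Theorems.FrustratedLawDichotomyStrainedPatchHomSlopeLJAffine
open Summit.AtomisticToContinuum.Crystallization.Theorems.FrustratedLawDichotomyStrainedPatchHomSlopeLJAffine2Kit

set_option maxRecDepth 100000 in
set_option maxHeartbeats 4000000 in
/-- ★ KERNEL: the non-slope conjuncts of the certificate side of the six-coarse cell (curvature floor `λ₁ = 0.639`). -/
theorem restBXA2 : htCertRestA2 pBXA2 JB065 cB065 wBXA = true := by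
  decide +kernel

set_option maxRecDepth 100000 in
set_option maxHeartbeats 4000000 in
/-- ★ KERNEL: `g₀ + lin + ⌈√ΣQ²⌉ + rem3 + nai ≤ GnBX`. -/
theorem linBXA2 : g0LJ cB065 (htScA2F cB065 wBXA JB065 (htNearU cB065 wBXA)) + linLJA cB065 wBXA JB065 (htScA2F cB065 wBXA JB065 (htNearU cB065 wBXA)) + sqrtQ QBX +
    rem3LJ cB065 (hullW JB065 wBXA) (htScA2F cB065 wBXA JB065 (htNearU cB065 wBXA)) + naiSLJ cB065 (hullW JB065 wBXA) (htSnA2F cB065 wBXA JB065 (htNearU cB065 wBXA)) ≤ GnBX := by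
  decide +kernel

set_option maxRecDepth 100000 in
set_option maxHeartbeats 4000000 in
/-- KERNEL: `GnBX + far₁ + far₂ ≤ Gs`. -/
theorem farBXA2 : GnBX + htGsNA cB065 wBXA JB065 (htFar1U cB065 wBXA) + htGsNA cB065 wBXA JB065 (htFar2U cB065 wBXA) ≤ pBXA2.Gs := by
  decide +kernel

/-- ★★★ **THE CERTIFICATE SIDE OF THE SIX-COARSE MIXED CELL HOLDS** (six kernel facts). [assembly] -/
theorem htCertSideA2Q_BXA2 : htCertSideA2Q pBXA2 QBX GnBX JB065 cB065 wBXA = true :=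
  htCertSideA2Q_of_parts restBXA2 qBX_0 qBX_1 qBX_2 linBXA2 farBXA2

end Summit.AtomisticToContinuum.Crystallization.Theorems.FrustratedLawDichotomyStrainedPatchHomEntryLeafHT
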